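import Summits.BirchSwinnertonDyer.BirchSwinnertonDyer.Theorems.QuadraticBranchSignedControlPlusEtaNonsurjMultiplicativeFrobenius
import Summits.BirchSwinnertonDyer.BirchSwinnertonDyer.Theorems.QuadraticBranchSignedControlPlusEtaNonsurjCartanFieldInert
import Literature.NumberTheory.EllipticCurves.BSDSelmerPConverseSerreProofs
import Literature.NumberTheory.EllipticCurves.RootNumberTwistProofs
import HarnessLib

/-!
# Route `QuadraticBranchSignedControl` (rung K8, cell `bsd-potss`): crux stmt-BirchSwinnertonDyer-19606
# `PlusEtaMainConjectureNonsurj` — THE MULTIPLICATIVE PRIMES OF A ROW ARE `≡ ±1 (mod p)`: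
# `ℓ ≡ 1 ⟺ Frob_ℓ ∈ H_V` (`ℓ` split in the Cartan field `K_V`), `ℓ ≡ −1 ⟺ Frob_ℓ ∉ H_V` (`ℓ` inert)

WHAT (the kernel form of FINDING-19606-k8eta-c2-g11 §2e: «all 368 multiplicative primes `ℓ` of the 336 rows of the
height-20 `X_ns⁺(5)` table are `≡ ±1 (mod 5)`, `≡ +1` iff split in `K_V`, 0 exceptions»; part 2, the row theorems —
part 1 is `…PlusEtaNonsurjMultiplicativeFrobenius`). On a row of crux 19606 (`V/ℚ` globally minimal, `p ≥ 5` good with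
`a_p = 0`, `p`-adic tower not onto) the image of `ρ̄_{V,p}` is the normaliser `C_ns⁺(p)` of a non-split Cartan
subgroup (`hasModPImageEqNonsplitCartanNormalizer_of_row`) and `H_V = ρ̄⁻¹(C_ns(p))` is the absolute Galois group of
the Cartan field `K_V` (`…CartanField`). Let `ℓ ≠ p` be a prime of multiplicative reduction and `σ₁ = τ|_{ℚ̄}` the
restriction of a local arithmetic Frobenius. Part 1 gives a NON-ZERO `P ∈ V[p]` with `σ₁ • P = (± ℓ) • P`, and
`det ρ̄(σ₁) = χ_p(σ₁) = ℓ` (Weil pairing, `det_eq_modNCyclotomicCharacter`); the `C_ns⁺(ε)` algebra of part 1 then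
forces `ℓ ≡ 1` when `ρ̄(σ₁) ∈ C_ns(ε)` and `ℓ ≡ −1` when `ρ̄(σ₁) ∉ C_ns(ε)`:

* §3 `natCast_eq_one_and_centralizes_sq_or_of_row` (the dichotomy for `σ₁`) and
  **`natCast_eq_one_or_eq_neg_one_of_hasMultiplicativeReduction_of_row`** — on every row, every multiplicative
  `ℓ ≠ p` has `(ℓ : 𝔽_p) = 1 ∨ (ℓ : 𝔽_p) = −1`; integer form `dvd_sub_one_or_dvd_add_one_…`; corollaries
  `le_add_one_of_hasMultiplicativeReduction_of_row` (`p ≤ ℓ + 1`) and **no row is multiplicative at `2` or `3`**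
  (`not_hasMultiplicativeReductionAtPrime_two_of_row`, `…_three_of_row`).
* §4 **`centralizes_sq_iff_natCast_eq_one_of_row`** — for EVERY prime `𝔓 ∣ ℓ` of `ℤ̄` and EVERY arithmetic
  Frobenius `σ` at `𝔓`: `σ ∈ H_V` (`ℓ` SPLITS in `K_V`) `⟺ (ℓ : 𝔽_p) = 1`; `not_centralizes_sq_iff_natCast_eq_neg_one_of_row`:
  `σ ∉ H_V` (`ℓ` INERT in `K_V`) `⟺ (ℓ : 𝔽_p) = −1`. Reduction to `σ₁`: `σ = j · gσ₁g⁻¹` with `j ∈ I_𝔓 ≤ H_V` (g10's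
  `inertia_centralizes_sq_of_row`; Mathlib `IsArithFrobAt.mul_inv_mem_inertia`, `.conj`;
  `exists_smul_eq_of_mem_primesAbove_holds`) and `H_V ⊴ Γ_ℚ` of index `2`.

Consequences recorded in the memo (not here): the Tamagawa law of `…TamagawaSplit` reads «`p ∣ c_ℓ` iff `ℓ` split
multiplicative», and in the Corpuz–Lei / Hatley–Lei local terms at `ℓ ∥ N_V` one has `η(ℓ) = (ℓ/5) = +1` always.

HONEST FRAMING (cell `bsd-potss`, run/shared/lean/pub/bsd-potss/; FULL-BSD rank ≤ 1 programme): TOOL THEOREMS ONLY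
(no definition, no named fact, no `sorry`, axioms standard). Nothing is booked; crux 19606 stays OPEN; `BSD(W, p)` is
claimed for no pair. Seat `bsd-potss-k8eta-c2` g12 (prover), `--supports stmt-BirchSwinnertonDyer-19606`.

References: [SilvermanATAEC1994] Lemma V.5.2 (c), Thm. V.5.3, Cor. V.5.4 (PDF pp. 406–410); [Serre1972] §2.2
(`C_ns⁺`), §1.11–1.12; [SilvermanAEC2009] III.8 (Weil pairing: `det ρ̄ = χ_p`); K. Ribet, Invent. Math. 100 (1990)
§1 / F. Diamond, «The refined conjecture of Serre» (1995) (the trace form `a_ℓ ≡ ±(ℓ+1)` of the same local fact).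
-/

set_option autoImplicit false
set_option linter.dupNamespace false

noncomputable section

open scoped Classical NNReal

open Matrix Field IsDedekindDomain NumberField WeierstrassCurve Literature.NumberTheory.EllipticCurves
  Literature.NumberTheory.GaloisRepresentations Literature.NumberTheory.SerreUniformity
  Rat.HeightOneSpectrum IsDedekindDomain.HeightOneSpectrum

namespace Summit.BirchSwinnertonDyer.BirchSwinnertonDyer.Theorems.EtaCartanField

/-! ## §3 On a row of crux 19606 every multiplicative prime `ℓ ≠ p` is `≡ ±1 (mod p)` -/

section Row

variable (V : WeierstrassCurve ℚ) [V.IsElliptic] [V.IsGloballyMinimal] (p : ℕ) [hp : Fact p.Prime]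

/-- **Core dichotomy.** On a row (`V/ℚ` globally minimal, `p ≥ 5` good, `a_p = 0`, tower not onto), at a place `v`
of multiplicative reduction with `char v = ℓ ≠ p`, for every local arithmetic Frobenius `τ ∈ Γ_{ℚ_v}` at a prime
`𝔐` of `\bar ℤ_v`: EITHER `ℓ ≡ 1 (mod p)` and `σ₁ = τ|_{ℚ̄}` centralises the squares on `V[p]` (`σ₁ ∈ H_V`), OR
`ℓ ≡ −1 (mod p)` and `σ₁` does not (`σ₁ ∉ H_V`). Proof: `ρ̄(σ₁) ∈ C_ns⁺(ε)` has the rational eigenvector of §2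
with eigenvalue `± ℓ` and determinant `χ_p(σ₁) = ℓ` (`det_eq_modNCyclotomicCharacter`); apply §1.
[cite: Serre1972, §2.2, §1.11–§1.12] [cite: SilvermanATAEC1994, Lemma V.5.2 (c), Thm. V.5.3, Cor. V.5.4 (PDF pp. 406–410)] -/
theorem natCast_eq_one_and_centralizes_sq_or_of_row (hp5 : 5 ≤ p) (hgood : V.HasGoodReductionAtPrime p)
    (hap : V.frobeniusTrace p = 0) (hns : ¬ ∀ m : ℕ, V.HasSurjectiveModNGaloisRep (p ^ m : ℕ))
    {ℓ : ℕ} (hℓp : ℓ ≠ p) {v : HeightOneSpectrum (𝓞 ℚ)} (hv : (primesEquiv v : ℕ) = ℓ)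
    (hmult : V.HasMultiplicativeReductionAt v) {𝔐 : Ideal v.localAbsIntegers} (h𝔐 : 𝔐 ∈ v.localPrimesAbove)
    {τ : absoluteGaloisGroup (v.adicCompletion ℚ)} (hτ : IsArithFrobAt (v.adicCompletionIntegers ℚ) τ 𝔐) :
    ((ℓ : ZMod p) = 1 ∧ ∀ (ν : absoluteGaloisGroup ℚ) (P : V.geomTorsion p),
        resGalOfEmb (closureEmb (K := ℚ) (v.adicCompletion ℚ)) τ • ((ν * ν) • P) =
          (ν * ν) • (resGalOfEmb (closureEmb (K := ℚ) (v.adicCompletion ℚ)) τ • P)) ∨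
    ((ℓ : ZMod p) = -1 ∧ ¬ ∀ (ν : absoluteGaloisGroup ℚ) (P : V.geomTorsion p),
        resGalOfEmb (closureEmb (K := ℚ) (v.adicCompletion ℚ)) τ • ((ν * ν) • P) =
          (ν * ν) • (resGalOfEmb (closureEmb (K := ℚ) (v.adicCompletion ℚ)) τ • P)) := by
  have hpp : p.Prime := hp.out
  have hp2 : p ≠ 2 := by omega
  have hℓ : ℓ.Prime := hv ▸ (primesEquiv v).2
  haveI : NeZero p := ⟨hpp.ne_zero⟩
  set σ₁ : absoluteGaloisGroup ℚ := resGalOfEmb (closureEmb (K := ℚ) (v.adicCompletion ℚ)) τ with hσ₁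
  -- the frame of the row and the matrix of `σ₁`
  obtain ⟨e, ε, hε, himg, hsurj⟩ := hasModPImageEqNonsplitCartanNormalizer_of_row V p hp5 hgood hap hns
  obtain ⟨M, hM, hσM⟩ := himg σ₁
  -- the rational eigenvector of eigenvalue `s ℓ`
  obtain ⟨s, hs, P, hP0, hσP⟩ :=
    exists_eigenvector_resGalOfEmb_of_hasMultiplicativeReductionAt V hmult hpp hv hℓp h𝔐 hτ
  rw [← hσ₁] at hσP
  set x : Fin 2 → ZMod p := e P with hx
  have hx0 : x ≠ 0 := fun h0 => hP0 (e.injective (by rw [← hx, h0, map_zero]))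
  have hMx : M *ᵥ x = ((s : ZMod p) * (ℓ : ZMod p)) • x := by
    rw [hx, ← hσM P, hσP, map_zsmul, ← Int.cast_smul_eq_zsmul (ZMod p), Int.cast_mul, Int.cast_natCast]
  have hs2 : (s : ZMod p) ^ 2 = 1 := by
    rcases hs with rfl | rfl
    · rw [Int.cast_one, one_pow]
    · rw [Int.cast_neg, Int.cast_one, neg_one_sq]
  -- `det = χ_p(σ₁) = ℓ`
  have hdet : M.det = (ℓ : ZMod p) := by
    rw [det_eq_modNCyclotomicCharacter V p hpp.two_le e σ₁ M hσM, hσ₁,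
      modNCyclotomicCharacter_resGalOfEmb_eq_of_isArithFrobAt hv hℓp h𝔐 hτ]
  have hℓ0 : (ℓ : ZMod p) ≠ 0 := by
    rw [Ne, ZMod.natCast_eq_zero_iff]
    exact fun h => hℓp ((Nat.prime_dvd_prime_iff_eq hpp hℓ).mp h).symm
  by_cases hMC : M ∈ nonsplitCartan ε
  · refine Or.inl ⟨eq_one_of_mem_nonsplitCartan_of_mulVec_eq hε hMC hx0 hs2 hMx hdet hℓ0, ?_⟩
    exact (matrix_mem_nonsplitCartan_iff_centralizes_sq hp2 e hε himg hsurj hM hσM).mp hMC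
  · refine Or.inr ⟨eq_neg_one_of_not_mem_nonsplitCartan_of_mulVec_eq hM hMC hx0 hs2 hMx hdet hℓ0, ?_⟩
    exact fun hcen => hMC ((matrix_mem_nonsplitCartan_iff_centralizes_sq hp2 e hε himg hsurj hM hσM).mpr hcen)

omit [V.IsGloballyMinimal] hp in
/-- `HasMultiplicativeReductionAtPrime ℓ` at the place `v` with `char v = ℓ` is `HasMultiplicativeReductionAt v`. [folklore] -/
theorem hasMultiplicativeReductionAt_of_primesEquiv_eq {ℓ : ℕ} [hℓ : Fact ℓ.Prime]
    (hmult : V.HasMultiplicativeReductionAtPrime ℓ) {v : HeightOneSpectrum (𝓞 ℚ)} (hv : (primesEquiv v : ℕ) = ℓ) :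
    V.HasMultiplicativeReductionAt v := by
  have hmult_v : haveI := Fact.mk (primesEquiv v).2; V.HasMultiplicativeReductionAtPrime (primesEquiv v) := by
    have key : ∀ (q : ℕ) (hq : Fact q.Prime), q = ℓ → @WeierstrassCurve.HasMultiplicativeReductionAtPrime V q hq := by
      rintro q hq rfl; exact hmult
    exact key _ _ hv
  exact (hasMultiplicativeReductionAtPrime_iff_hasMultiplicativeReductionAt_ringOfIntegers V v).mp hmult_v

/-- **The multiplicative primes of a row are `≡ ±1 (mod p)`.** On every row of crux 19606 (`V/ℚ` globally minimal,
`p ≥ 5` good with `a_p = 0`, `p`-adic tower not onto) every prime `ℓ ≠ p` of multiplicative reduction satisfies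
`(ℓ : 𝔽_p) = 1 ∨ (ℓ : 𝔽_p) = −1` (FINDING-19606-k8eta-c2-g11 §2e: 368/368 multiplicative primes of the height-20
`X_ns⁺(5)` table). [cite: Serre1972, §2.2, §1.11–§1.12]
[cite: SilvermanATAEC1994, Lemma V.5.2 (c), Thm. V.5.3, Cor. V.5.4 (PDF pp. 406–410)] -/
theorem natCast_eq_one_or_eq_neg_one_of_hasMultiplicativeReduction_of_row (hp5 : 5 ≤ p)
    (hgood : V.HasGoodReductionAtPrime p) (hap : V.frobeniusTrace p = 0)
    (hns : ¬ ∀ m : ℕ, V.HasSurjectiveModNGaloisRep (p ^ m : ℕ)) (ℓ : ℕ) [hℓ : Fact ℓ.Prime] (hℓp : ℓ ≠ p)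
    (hmult : V.HasMultiplicativeReductionAtPrime ℓ) : (ℓ : ZMod p) = 1 ∨ (ℓ : ZMod p) = -1 := by
  set v : HeightOneSpectrum (𝓞 ℚ) := (primesEquiv (R := 𝓞 ℚ)).symm ⟨ℓ, hℓ.out⟩ with hvdef
  have hv : (primesEquiv v : ℕ) = ℓ := by rw [hvdef, Equiv.apply_symm_apply]
  obtain ⟨𝔐, h𝔐⟩ := v.localPrimesAbove_nonempty
  obtain ⟨τ, hτ⟩ := exists_isArithFrobAt_localAbsIntegers v h𝔐
  rcases natCast_eq_one_and_centralizes_sq_or_of_row V p hp5 hgood hap hns hℓp hv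
      (hasMultiplicativeReductionAt_of_primesEquiv_eq V hmult hv) h𝔐 hτ with ⟨h, -⟩ | ⟨h, -⟩
  · exact Or.inl h
  · exact Or.inr h

/-- **Integer form: `p ∣ ℓ − 1` or `p ∣ ℓ + 1`** for every multiplicative prime `ℓ ≠ p` of a row.
[cite: Serre1972, §2.2, §1.11–§1.12] -/
theorem dvd_sub_one_or_dvd_add_one_of_hasMultiplicativeReduction_of_row (hp5 : 5 ≤ p)
    (hgood : V.HasGoodReductionAtPrime p) (hap : V.frobeniusTrace p = 0)
    (hns : ¬ ∀ m : ℕ, V.HasSurjectiveModNGaloisRep (p ^ m : ℕ)) (ℓ : ℕ) [Fact ℓ.Prime] (hℓp : ℓ ≠ p)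
    (hmult : V.HasMultiplicativeReductionAtPrime ℓ) : (p : ℤ) ∣ (ℓ : ℤ) - 1 ∨ (p : ℤ) ∣ (ℓ : ℤ) + 1 := by
  haveI : NeZero p := ⟨hp.out.ne_zero⟩
  rcases natCast_eq_one_or_eq_neg_one_of_hasMultiplicativeReduction_of_row V p hp5 hgood hap hns ℓ hℓp hmult
    with h | h
  · left
    have h' : ((((ℓ : ℤ) - 1 : ℤ)) : ZMod p) = 0 := by rw [Int.cast_sub, Int.cast_natCast, Int.cast_one, h, sub_self]
    exact (ZMod.intCast_zmod_eq_zero_iff_dvd _ p).mp h'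
  · right
    have h' : ((((ℓ : ℤ) + 1 : ℤ)) : ZMod p) = 0 := by
      rw [Int.cast_add, Int.cast_natCast, Int.cast_one, h, neg_add_cancel]
    exact (ZMod.intCast_zmod_eq_zero_iff_dvd _ p).mp h'

/-- **Corollary: `p ≤ ℓ + 1`** for every multiplicative prime `ℓ ≠ p` of a row (so `ℓ ≥ 4`: the primes `2` and `3`
are never multiplicative on a row of crux 19606). [cite: Serre1972, §2.2, §1.11–§1.12] -/
theorem le_add_one_of_hasMultiplicativeReduction_of_row (hp5 : 5 ≤ p) (hgood : V.HasGoodReductionAtPrime p)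
    (hap : V.frobeniusTrace p = 0) (hns : ¬ ∀ m : ℕ, V.HasSurjectiveModNGaloisRep (p ^ m : ℕ)) (ℓ : ℕ)
    [hℓ : Fact ℓ.Prime] (hℓp : ℓ ≠ p) (hmult : V.HasMultiplicativeReductionAtPrime ℓ) : p ≤ ℓ + 1 := by
  have hℓ2 : 2 ≤ ℓ := hℓ.out.two_le
  rcases dvd_sub_one_or_dvd_add_one_of_hasMultiplicativeReduction_of_row V p hp5 hgood hap hns ℓ hℓp hmult
    with h | h
  · have h1 : (p : ℤ) ≤ (ℓ : ℤ) - 1 := Int.le_of_dvd (by omega) h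
    omega
  · have h1 : (p : ℤ) ≤ (ℓ : ℤ) + 1 := Int.le_of_dvd (by omega) h
    omega

/-- **No row of crux 19606 has multiplicative reduction at `2`.** [cite: Serre1972, §2.2, §1.11–§1.12] -/
theorem not_hasMultiplicativeReductionAtPrime_two_of_row (hp5 : 5 ≤ p) (hgood : V.HasGoodReductionAtPrime p)
    (hap : V.frobeniusTrace p = 0) (hns : ¬ ∀ m : ℕ, V.HasSurjectiveModNGaloisRep (p ^ m : ℕ)) :
    ¬ @WeierstrassCurve.HasMultiplicativeReductionAtPrime V 2 ⟨Nat.prime_two⟩ := by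
  intro h
  have := @le_add_one_of_hasMultiplicativeReduction_of_row V _ _ p hp hp5 hgood hap hns 2 ⟨Nat.prime_two⟩
    (by omega) h
  omega

/-- **No row of crux 19606 has multiplicative reduction at `3`.** [cite: Serre1972, §2.2, §1.11–§1.12] -/
theorem not_hasMultiplicativeReductionAtPrime_three_of_row (hp5 : 5 ≤ p) (hgood : V.HasGoodReductionAtPrime p)
    (hap : V.frobeniusTrace p = 0) (hns : ¬ ∀ m : ℕ, V.HasSurjectiveModNGaloisRep (p ^ m : ℕ)) :
    ¬ @WeierstrassCurve.HasMultiplicativeReductionAtPrime V 3 ⟨Nat.prime_three⟩ := by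
  intro h
  have := @le_add_one_of_hasMultiplicativeReduction_of_row V _ _ p hp hp5 hgood hap hns 3 ⟨Nat.prime_three⟩
    (by omega) h
  omega

/-! ## §4 `ℓ ≡ 1 (mod p) ⟺ Frob_ℓ ∈ H_V` (`ℓ` splits in the Cartan field) — for every Frobenius at every `𝔓 ∣ ℓ` -/

/-- **`ℓ ≡ 1 (mod p) ⟺ Frob_ℓ ∈ H_V`.** On a row of crux 19606, for every multiplicative prime `ℓ ≠ p`, every
prime `𝔓` of `ℤ̄` above `ℓ` and every arithmetic Frobenius `σ ∈ Γ_ℚ` at `𝔓`: `σ` centralises the squares on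
`V[p]` (`σ ∈ H_V = Γ_{K_V}`, i.e. `ℓ` SPLITS in the Cartan field) iff `(ℓ : 𝔽_p) = 1`. Reduction to the restricted
local Frobenius `σ₁` of §3: `σ = j · gσ₁g⁻¹` with `j ∈ I_𝔓 ≤ H_V` (`inertia_centralizes_sq_of_row`, Mathlib
`IsArithFrobAt.mul_inv_mem_inertia` / `.conj`, `exists_smul_eq_of_mem_primesAbove_holds`) and `H_V ⊴ Γ_ℚ` of index
`2`. [cite: Serre1972, §2.2, §1.11–§1.12] [cite: SilvermanATAEC1994, Lemma V.5.2 (c), Thm. V.5.3, Cor. V.5.4 (PDF pp. 406–410)] -/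
theorem centralizes_sq_iff_natCast_eq_one_of_row (hp5 : 5 ≤ p) (hgood : V.HasGoodReductionAtPrime p)
    (hap : V.frobeniusTrace p = 0) (hns : ¬ ∀ m : ℕ, V.HasSurjectiveModNGaloisRep (p ^ m : ℕ)) (ℓ : ℕ)
    [hℓ : Fact ℓ.Prime] (hℓp : ℓ ≠ p) (hmult : V.HasMultiplicativeReductionAtPrime ℓ)
    {v : HeightOneSpectrum (𝓞 ℚ)} (hv : (primesEquiv v : ℕ) = ℓ)
    {𝔓 : Ideal (absIntegers (𝓞 ℚ) ℚ)} (h𝔓 : 𝔓 ∈ v.primesAbove) {σ : absoluteGaloisGroup ℚ}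
    (hσ : IsArithFrobAt (𝓞 ℚ) σ 𝔓) :
    (∀ (ν : absoluteGaloisGroup ℚ) (P : V.geomTorsion p), σ • ((ν * ν) • P) = (ν * ν) • (σ • P)) ↔
      (ℓ : ZMod p) = 1 := by
  have hpp : p.Prime := hp.out
  haveI : NeZero p := ⟨hpp.ne_zero⟩
  have hmultAt := hasMultiplicativeReductionAt_of_primesEquiv_eq V hmult hv
  -- a local Frobenius and its restriction `σ₁`, a Frobenius at `𝔓₁`
  obtain ⟨𝔐, h𝔐⟩ := v.localPrimesAbove_nonempty
  obtain ⟨τ, hτ⟩ := exists_isArithFrobAt_localAbsIntegers v h𝔐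
  set ι := closureEmb (K := ℚ) (v.adicCompletion ℚ) with hι
  set σ₁ : absoluteGaloisGroup ℚ := resGalOfEmb ι τ with hσ₁
  have h𝔓₁ : v.primeBelow ι 𝔐 ∈ v.primesAbove := primeBelow_mem_primesAbove h𝔐
  have hσ₁frob : IsArithFrobAt (𝓞 ℚ) σ₁ (v.primeBelow ι 𝔐) := WeierstrassCurve.isArithFrobAt_resGalOfEmb h𝔐 ι hτ
  -- the Cartan subgroup `H`, normal of index `2`
  obtain ⟨H, hH2, hHmem⟩ := exists_cartanSubgroup_of_row V p hp5 hgood hap hns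
  haveI hHN : H.Normal := Subgroup.normal_of_index_eq_two hH2
  -- conjugate `σ₁` to a Frobenius `σ'` at `𝔓`; `σ σ'⁻¹ ∈ I_𝔓 ≤ H`
  obtain ⟨g, hg⟩ := exists_smul_eq_of_mem_primesAbove_holds (K := ℚ) (v := v) h𝔓₁ h𝔓
  have hσ' : IsArithFrobAt (𝓞 ℚ) (g * σ₁ * g⁻¹) 𝔓 := by rw [← hg]; exact hσ₁frob.conj g
  have hjI : σ * (g * σ₁ * g⁻¹)⁻¹ ∈ 𝔓.inertia (absoluteGaloisGroup ℚ) := hσ.mul_inv_mem_inertia hσ'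
  have hjH : σ * (g * σ₁ * g⁻¹)⁻¹ ∈ H :=
    (hHmem _).mpr (inertia_centralizes_sq_of_row V p hp5 hgood hap hns (Or.inr (Or.inr hmultAt)) h𝔓 hjI)
  -- `σ ∈ H ↔ σ₁ ∈ H`
  have hiff : σ ∈ H ↔ σ₁ ∈ H := by
    have hσeq : σ = (σ * (g * σ₁ * g⁻¹)⁻¹) * (g * σ₁ * g⁻¹) := by group
    constructor
    · intro hσH
      have h1 : g * σ₁ * g⁻¹ ∈ H := by
        have := H.mul_mem (H.inv_mem hjH) hσH
        rwa [show (σ * (g * σ₁ * g⁻¹)⁻¹)⁻¹ * σ = g * σ₁ * g⁻¹ by group] at this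
      have h2 := hHN.conj_mem _ h1 g⁻¹
      rwa [show g⁻¹ * (g * σ₁ * g⁻¹) * g⁻¹⁻¹ = σ₁ by group] at h2
    · intro hσ₁H
      rw [hσeq]
      exact H.mul_mem hjH (hHN.conj_mem _ hσ₁H g)
  -- the dichotomy for `σ₁`
  have h1ne : (1 : ZMod p) ≠ -1 := by
    intro h
    have h2 : ((2 : ℕ) : ZMod p) = 0 := by
      rw [Nat.cast_ofNat]
      linear_combination h
    rw [ZMod.natCast_eq_zero_iff] at h2
    have := (Nat.prime_dvd_prime_iff_eq hpp Nat.prime_two).mp h2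
    omega
  rw [← hHmem σ, hiff, hHmem σ₁]
  rcases natCast_eq_one_and_centralizes_sq_or_of_row V p hp5 hgood hap hns hℓp hv hmultAt h𝔐 hτ with
    ⟨hℓ1, hcen⟩ | ⟨hℓ1, hcen⟩
  · exact ⟨fun _ => hℓ1, fun _ => hcen⟩
  · constructor
    · exact fun h => absurd h hcen
    · intro h; rw [h] at hℓ1; exact absurd hℓ1 h1ne

/-- **`ℓ ≡ −1 (mod p) ⟺ Frob_ℓ ∉ H_V`** (`ℓ` INERT in the Cartan field `K_V`): the complementary reading of
`centralizes_sq_iff_natCast_eq_one_of_row` via §3's dichotomy. [cite: Serre1972, §2.2, §1.11–§1.12] -/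
theorem not_centralizes_sq_iff_natCast_eq_neg_one_of_row (hp5 : 5 ≤ p) (hgood : V.HasGoodReductionAtPrime p)
    (hap : V.frobeniusTrace p = 0) (hns : ¬ ∀ m : ℕ, V.HasSurjectiveModNGaloisRep (p ^ m : ℕ)) (ℓ : ℕ)
    [hℓ : Fact ℓ.Prime] (hℓp : ℓ ≠ p) (hmult : V.HasMultiplicativeReductionAtPrime ℓ)
    {v : HeightOneSpectrum (𝓞 ℚ)} (hv : (primesEquiv v : ℕ) = ℓ)
    {𝔓 : Ideal (absIntegers (𝓞 ℚ) ℚ)} (h𝔓 : 𝔓 ∈ v.primesAbove) {σ : absoluteGaloisGroup ℚ}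
    (hσ : IsArithFrobAt (𝓞 ℚ) σ 𝔓) :
    (¬ ∀ (ν : absoluteGaloisGroup ℚ) (P : V.geomTorsion p), σ • ((ν * ν) • P) = (ν * ν) • (σ • P)) ↔
      (ℓ : ZMod p) = -1 := by
  have hpp : p.Prime := hp.out
  haveI : NeZero p := ⟨hpp.ne_zero⟩
  have h1ne : (1 : ZMod p) ≠ -1 := by
    intro h
    have h2 : ((2 : ℕ) : ZMod p) = 0 := by
      rw [Nat.cast_ofNat]
      linear_combination h
    rw [ZMod.natCast_eq_zero_iff] at h2
    have := (Nat.prime_dvd_prime_iff_eq hpp Nat.prime_two).mp h2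
    omega
  rw [centralizes_sq_iff_natCast_eq_one_of_row V p hp5 hgood hap hns ℓ hℓp hmult hv h𝔓 hσ]
  rcases natCast_eq_one_or_eq_neg_one_of_hasMultiplicativeReduction_of_row V p hp5 hgood hap hns ℓ hℓp hmult
    with h | h
  · rw [h]; exact ⟨fun hne => absurd rfl hne, fun h1 => absurd h1 h1ne⟩
  · rw [h]; exact ⟨fun _ => rfl, fun _ => Ne.symm h1ne⟩

end Row

end Summit.BirchSwinnertonDyer.BirchSwinnertonDyer.Theorems.EtaCartanField

end
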